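import Summits.QuantumFields.GaugeBoot.BootstrapFunctionals
import HarnessLib

/-!
# Lattice symmetries of the bootstrap: relabelling invariance, translation invariance from uniqueness, and the reduction of the loop equations to one base site (gauge-boot, L1 supplement)

HONEST FRAMING (cell `pub-gaugeboot`, page 1 of every file): the venture produces certified bounds
on lattice expectations at stated coupling, gauge group, dimension and torus size; NOT a mass gap,
NOT a continuum limit, NOT a string tension; NOT Yang–Mills-summit-bearing (barriers
`FixedCouplingUltralocality`, `PerturbativeInvisibility`). Structural; it certifies no number.

## Content

A practical lattice bootstrap (Anderson–Kruczenski; Kazakov–Zheng) imposes the lattice symmetries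
on the unknowns and writes the loop equations only at ONE base site. This file proves both moves
sound for the tree's bootstrap functionals (`IsSDFunctional`), for any RELABELLING of the links
`π : ι ≃ ι` compatible with the local actions (`S_e (U ∘ π) = S_{π e} U`; on the torus: the
translations, `wilsonAction_comp_translateEquiv`):

* `relabelCM π` (`U ↦ U ∘ π`), `comp_relabelCM_mem_polyAlgebra` (polynomials are relabelling
  stable), `relabelCM_update` / `hasDerivAt_comp_relabelCM` (a one-link shift at `π e` is carried to
  the shift at `e`);
* ★★ `IsSDFunctional.comp_relabel` — if `φ` satisfies all loop equations, so does `f ↦ φ (f ∘ π)`;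
* ★★★ `integral_comp_translate_eq_wilson_suN` / `_uN` — CONSEQUENTLY (bootstrap uniqueness,
  `eq_wilson_of_bootstrap_suN`) the Wilson expectation of every polynomial observable on the torus
  `(ℤ/L)^d` is translation invariant, `∫ f(U(· + a)) dμ = ∫ f dμ` — so imposing translation invariance
  as extra linear constraints on a truncation keeps the Wilson value feasible;
* ★★★ `isSDFunctional_of_invariant_of_rows_at` — the REDUCTION: a functional invariant (on the
  polynomials) under a family of compatible relabellings which satisfies the loop equations at a
  set of links meeting every orbit satisfies ALL loop equations; ★★★
  `isSDFunctional_of_translationInvariant_suN` / `_uN` — torus: a translation-invariant functional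
  satisfying the loop equations at the `d` links `(0, i)` satisfies them at every link.

What this is NOT: axis permutations / reflections are not instantiated (reflections reverse link
orientation and are not pure relabellings); nothing about rates.

References: P. Anderson, M. Kruczenski, Nucl. Phys. B 921 (2017) §3; V. Kazakov, Z. Zheng,
arXiv:2203.11360 §3 (symmetry reduction of the SDP). Folklore.
-/

noncomputable section

open MeasureTheory Filter Topology NormedSpace
open Literature.MathematicalPhysics.QuantumFieldTheory (haarProbability LatticeRep)

namespace Summit.QuantumFields.GaugeBoot

/-! ## Relabelling of links -/

section Relabel

variable {ι : Type*} [DecidableEq ι] {G : Type*} [Group G] [TopologicalSpace G] (r : LatticeRep G)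

/-- **Relabelling of the links** by `π : ι → ι`: `U ↦ U ∘ π`, a continuous self-map of the
configurations (translations of the torus: `π (x, i) = (x + a, i)`). [folklore] -/
def relabelCM (π : ι → ι) : C(ι → G, ι → G) :=
  ⟨fun U => U ∘ π, continuous_pi fun e => continuous_apply (π e)⟩

omit [DecidableEq ι] [Group G] in
/-- `relabelCM` as a function. -/
theorem coe_relabelCM (π : ι → ι) : ⇑(relabelCM (G := G) π) = fun U => U ∘ π := rfl

omit [DecidableEq ι] [Group G] in
/-- `relabelCM` evaluated. -/
@[simp] theorem relabelCM_apply (π : ι → ι) (U : ι → G) (e : ι) : relabelCM (G := G) π U e = U (π e) := rfl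

omit [DecidableEq ι] in
/-- **The polynomial observables are relabelling stable**: generators go to generators. -/
theorem comp_relabelCM_mem_polyAlgebra (π : ι → ι) {f : C(ι → G, ℝ)} (hf : f ∈ polyAlgebra (ι := ι) r) :
    f.comp (relabelCM π) ∈ polyAlgebra (ι := ι) r := by
  have h : polyAlgebra (ι := ι) r ≤ (polyAlgebra (ι := ι) r).comap
      (ContinuousMap.compRightAlgHom ℝ ℝ (relabelCM (G := G) π)) := by
    refine Algebra.adjoin_le ?_
    rintro _ (⟨⟨e, a, b⟩, rfl⟩ | ⟨⟨e, a, b⟩, rfl⟩)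
    · change (reEntry r e a b).comp (relabelCM π) ∈ polyAlgebra (ι := ι) r
      have : (reEntry r e a b).comp (relabelCM (G := G) π) = reEntry r (π e) a b := by ext U; rfl
      rw [this]
      exact reEntry_mem r _ a b
    · change (imEntry r e a b).comp (relabelCM π) ∈ polyAlgebra (ι := ι) r
      have : (imEntry r e a b).comp (relabelCM (G := G) π) = imEntry r (π e) a b := by ext U; rfl
      rw [this]
      exact imEntry_mem r _ a b
  exact h hf

omit [Group G] in
/-- **A one-link update at `π e` is carried by the relabelling to the update at `e`** (`π` injective).
-/
theorem relabelCM_update (π : ι ≃ ι) (U : ι → G) (e : ι) (x : G) :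
    relabelCM (G := G) π (Function.update U (π e) x) = Function.update (relabelCM (G := G) π U) e x := by
  funext e'
  simp only [relabelCM_apply, Function.update_apply, π.apply_eq_iff_eq]

/-- **Derivatives are carried along**: if `f'` is the derivative of `f` along the shift at `e`, then
`f' ∘ π` is the derivative of `f ∘ π` along the shift at `π e`. -/
theorem hasDerivAt_comp_relabelCM (π : ι ≃ ι) {κ : ℝ → G} {f f' : (ι → G) → ℝ} (e : ι)
    (hf' : ∀ V, HasDerivAt (fun t => f (Function.update V e (κ t * V e))) (f' V) 0) (U : ι → G) :
    HasDerivAt (fun t => f (relabelCM (G := G) π (Function.update U (π e) (κ t * U (π e)))))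
      (f' (relabelCM (G := G) π U)) 0 := by
  simp only [relabelCM_update]
  exact hf' (relabelCM (G := G) π U)

variable {K : Type*} {k : K → ℝ → G} {S : ι → (ι → G) → ℝ} {β : ℝ}

/-- The derivative of the local action at `π e` is the relabelled derivative at `e`, for compatible
local actions `S_e (U ∘ π) = S_{π e} U`. -/
theorem hasDerivAt_action_relabel (π : ι ≃ ι) (hS : ∀ e U, S e (relabelCM (G := G) π U) = S (π e) U)
    (a : K) (e : ι) {S' : (ι → G) → ℝ}
    (hS' : ∀ V, HasDerivAt (fun t => S e (Function.update V e (k a t * V e))) (S' V) 0) (U : ι → G) :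
    HasDerivAt (fun t => S (π e) (Function.update U (π e) (k a t * U (π e))))
      (S' (relabelCM (G := G) π U)) 0 := by
  have h := hasDerivAt_comp_relabelCM π (κ := k a) e hS' U
  simp only [hS] at h
  exact h

/-- ★★ **Relabelling a Schwinger–Dyson functional gives a Schwinger–Dyson functional**: if `φ`
satisfies the loop equations at every link, so does `f ↦ φ (f ∘ π)` (compatible local actions).
[folklore] -/
theorem IsSDFunctional.comp_relabel (π : ι ≃ ι) (hS : ∀ e U, S e (relabelCM (G := G) π U) = S (π e) U)
    {φ : C(ι → G, ℝ) →ₗ[ℝ] ℝ} (hφ : IsSDFunctional r k S β φ) :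
    IsSDFunctional r k S β
      (φ ∘ₗ (ContinuousMap.compRightAlgHom ℝ ℝ (relabelCM (G := G) π)).toLinearMap) := by
  intro e a
  obtain ⟨S', hS'm, hS', -⟩ := hφ e a
  obtain ⟨S'', -, hS'', hrows⟩ := hφ (π e) a
  refine ⟨S', hS'm, hS', fun f hf f' hf'm hf' => ?_⟩
  -- the derivative of `S (π e)` along `π e` is `S' ∘ π`
  have hSe : ∀ U, S'' U = S' (relabelCM (G := G) π U) := fun U =>
    (hS'' U).unique (hasDerivAt_action_relabel π hS a e hS' U)
  have hrow := hrows (f.comp (relabelCM π)) (comp_relabelCM_mem_polyAlgebra r π hf)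
    (f'.comp (relabelCM π)) (comp_relabelCM_mem_polyAlgebra r π hf'm)
    (fun U => hasDerivAt_comp_relabelCM π (κ := k a) e hf' U)
  have hprod : f.comp (relabelCM (G := G) π) * S'' = (f * S').comp (relabelCM (G := G) π) := by
    ext U
    simp only [ContinuousMap.mul_apply, ContinuousMap.comp_apply, hSe U]
  rw [hprod] at hrow
  exact hrow

/-- **Schwinger–Dyson functional AT a set of links** `E₀`: the loop equations of `IsSDFunctional`
asked only at the links of `E₀`. [shape] A parametric definition of a proposition — NOT a fact.
[folklore] -/
def IsSDFunctionalAt (E₀ : Set ι) (k : K → ℝ → G) (S : ι → (ι → G) → ℝ) (β : ℝ)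
    (φ : C(ι → G, ℝ) →ₗ[ℝ] ℝ) : Prop :=
  ∀ i ∈ E₀, ∀ (a : K), ∃ S' ∈ polyAlgebra (ι := ι) r,
    (∀ U, HasDerivAt (fun t => S i (Function.update U i (k a t * U i))) (S' U) 0) ∧
      ∀ f ∈ polyAlgebra (ι := ι) r, ∀ f' ∈ polyAlgebra (ι := ι) r,
        (∀ U, HasDerivAt (fun t => f (Function.update U i (k a t * U i))) (f' U) 0) →
          φ f' = β * φ (f * S')

/-- All links: `IsSDFunctionalAt univ ↔ IsSDFunctional`. -/
theorem isSDFunctionalAt_univ_iff {φ : C(ι → G, ℝ) →ₗ[ℝ] ℝ} :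
    IsSDFunctionalAt r Set.univ k S β φ ↔ IsSDFunctional r k S β φ :=
  ⟨fun h i a => h i (Set.mem_univ i) a, fun h i _ a => h i a⟩

/-- ★★★ **Reduction of the loop equations to representatives.** Let `T` be a family of relabellings
compatible with the local actions, `φ` a linear functional invariant on the polynomials under every
`π ∈ T` (`φ (g ∘ π) = φ g`), and `E₀` a set of links such that every link is `π e₀` for some `π ∈ T`,
`e₀ ∈ E₀`. If `φ` satisfies the loop equations at the links of `E₀`, it satisfies them at EVERY link.
[folklore] -/
theorem isSDFunctional_of_invariant_of_rows_at [ContinuousMul G] (hk : ∀ a s t, k a (s + t) = k a s * k a t)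
    {X : K → Matrix (Fin r.N) (Fin r.N) ℂ} (hX : ∀ a t, r.ρ (k a t) = exp ((t : ℂ) • X a))
    (T : Set (ι ≃ ι)) (hS : ∀ π ∈ T, ∀ e U, S e (relabelCM (G := G) π U) = S (π e) U)
    {φ : C(ι → G, ℝ) →ₗ[ℝ] ℝ}
    (hφ : ∀ π ∈ T, ∀ g ∈ polyAlgebra (ι := ι) r, φ (g.comp (relabelCM π)) = φ g)
    (E₀ : Set ι) (hcover : ∀ e : ι, ∃ π ∈ T, ∃ e₀ ∈ E₀, e = π e₀)
    (hrows : IsSDFunctionalAt r E₀ k S β φ) : IsSDFunctional r k S β φ := by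
  intro e a
  obtain ⟨π, hπ, e₀, he₀, rfl⟩ := hcover e
  obtain ⟨S'₀, hS'₀m, hS'₀, hrows₀⟩ := hrows e₀ he₀ a
  refine ⟨S'₀.comp (relabelCM π), comp_relabelCM_mem_polyAlgebra r π hS'₀m,
    fun U => hasDerivAt_action_relabel π (hS π hπ) a e₀ hS'₀ U, fun f hf f' hf'm hf' => ?_⟩
  -- pull `f` back along `π`: `f = g ∘ π` with `g = f ∘ π⁻¹`
  set g : C(ι → G, ℝ) := f.comp (relabelCM (G := G) π.symm) with hg
  have hgm : g ∈ polyAlgebra (ι := ι) r := comp_relabelCM_mem_polyAlgebra r π.symm hf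
  have hfg : f = g.comp (relabelCM π) := by
    ext U
    simp only [hg, ContinuousMap.comp_apply]
    congr 1
    funext e'
    simp only [relabelCM_apply, Equiv.apply_symm_apply]
  obtain ⟨g', hg'm, hg'⟩ := exists_deriv_mem_polyAlgebra r (hk a) (hX a) e₀ hgm
  -- `f' = g' ∘ π` by uniqueness of derivatives
  have hf'e : f' = g'.comp (relabelCM π) := by
    ext U
    have h1 := hasDerivAt_comp_relabelCM π (κ := k a) e₀ hg' U
    have h2 := hf' U
    rw [hfg] at h2
    exact h2.unique h1
  rw [hf'e, hφ π hπ g' hg'm, hrows₀ g hgm g' hg'm hg', ← hφ π hπ (g * S'₀)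
    ((polyAlgebra (ι := ι) r).mul_mem hgm hS'₀m), hfg]
  rfl

end Relabel

/-! ## The torus: translations -/

section Torus

open Literature.MathematicalPhysics.QuantumFieldTheory (Site Edge Plaquette GaugeConfig plaquetteHolonomy
  wilsonAction wilsonMeasure)
open Literature.MathematicalPhysics.QuantumLattice

variable {d L : ℕ} {G : Type*} [Group G]

/-- **Translation of the torus by `a`** as a relabelling of the links: `(x, i) ↦ (x + a, i)`
(so `relabelCM (translateEquiv a) U = U(· + a)`, the tree's `GaugeConfig.siteTranslate a U`).
[folklore] -/
def translateEquiv (a : Site d L) : Edge d L ≃ Edge d L :=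
  (Equiv.addRight a).prodCongr (Equiv.refl (Fin d))

/-- `translateEquiv` evaluated. -/
@[simp] theorem translateEquiv_apply (a : Site d L) (e : Edge d L) : translateEquiv a e = (e.1 + a, e.2) := rfl

/-- Every link is a translate of a link at the origin. -/
theorem exists_translateEquiv_base (e : Edge d L) :
    ∃ a : Site d L, ∃ i : Fin d, e = translateEquiv a ((0 : Site d L), i) :=
  ⟨e.1, e.2, by simp⟩

/-- Plaquette holonomies of a translated configuration. -/
theorem plaquetteHolonomy_comp_translateEquiv (a : Site d L) (U : GaugeConfig d L G) (x : Site d L)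
    (i j : Fin d) : plaquetteHolonomy (U ∘ translateEquiv a) x i j = plaquetteHolonomy U (x + a) i j := by
  simp only [plaquetteHolonomy, Function.comp_apply, translateEquiv_apply, Site.shift, add_right_comm _ _ a]

variable {N : ℕ} (ρ : G →* Matrix (Fin N) (Fin N) ℂ)

/-- **The Wilson action is translation invariant.** -/
theorem wilsonAction_comp_translateEquiv [NeZero L] (a : Site d L) (U : GaugeConfig d L G) :
    wilsonAction ρ (U ∘ translateEquiv a) = wilsonAction ρ U := by
  unfold wilsonAction
  simp_rw [plaquetteHolonomy_comp_translateEquiv]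
  exact Fintype.sum_equiv ((Equiv.addRight a).prodCongr (Equiv.refl _)) _ _ fun p => rfl

variable [TopologicalSpace G]

/-- The constant family of local actions `S_e = S_Wilson` is compatible with the translations. -/
theorem wilsonAction_relabelCM_translate [NeZero L] (a : Site d L) (e : Edge d L) (U : GaugeConfig d L G) :
    (fun _ : Edge d L => wilsonAction ρ) e (relabelCM (G := G) (translateEquiv a) U) =
      (fun _ : Edge d L => wilsonAction ρ) (translateEquiv a e) U :=
  wilsonAction_comp_translateEquiv ρ a U

end Torus

/-! ## `SU(N)` and `U(N)`: translation invariance from uniqueness; the loop equations at one site -/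

section Unitary

open Literature.MathematicalPhysics.QuantumFieldTheory (Site Edge GaugeConfig wilsonAction wilsonMeasure
  isProbabilityMeasure_wilsonMeasure)
open Literature.MathematicalPhysics.QuantumLattice

variable {d L : ℕ}

/-- ★★★ **The Wilson expectations of `SU(N)` lattice gauge theory are translation invariant on the
polynomial observables** — proved from BOOTSTRAP UNIQUENESS: `f ↦ ∫ f(U(· + a)) dμ` is normalised,
square-positive and satisfies every loop equation (`IsSDFunctional.comp_relabel`), hence equals the
Wilson expectation (`eq_wilson_of_bootstrap_suN`). [folklore] -/
theorem integral_comp_translate_eq_wilson_suN [NeZero L] (N : ℕ) (β : ℝ) (a : Site d L)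
    {f : C(GaugeConfig d L (Matrix.specialUnitaryGroup (Fin N) ℂ), ℝ)}
    (hf : f ∈ polyAlgebra (ι := Edge d L) (fundamentalLatticeRep N)) :
    ∫ U, f (U ∘ translateEquiv a) ∂(wilsonMeasure (fundamentalRep (Fin N)) β) =
      ∫ U, f U ∂(wilsonMeasure (fundamentalRep (Fin N)) β) := by
  haveI : IsProbabilityMeasure (wilsonMeasure (d := d) (L := L) (fundamentalRep (Fin N)) β) :=
    isProbabilityMeasure_wilsonMeasure (ρ := fundamentalRep (Fin N)) (continuous_fundamentalRep _) β
  obtain ⟨-, hpos, hsd⟩ := bootstrap_wilson_suN (d := d) (L := L) N β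
    (wilsonMeasure (fundamentalRep (Fin N)) β) rfl
  set ψ := expectationFunctional (wilsonMeasure (d := d) (L := L) (fundamentalRep (Fin N)) β) ∘ₗ
    (ContinuousMap.compRightAlgHom ℝ ℝ (relabelCM (G := Matrix.specialUnitaryGroup (Fin N) ℂ)
      (translateEquiv a))).toLinearMap with hψ
  have h := eq_wilson_of_bootstrap_suN (d := d) (L := L) N β (φ := ψ) (by simp [hψ])
    (fun g _ => by simpa [hψ] using hpos (g.comp (relabelCM (translateEquiv a))))
    (hsd.comp_relabel _ (translateEquiv a) (wilsonAction_relabelCM_translate (fundamentalRep (Fin N)) a)) hf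
  simpa [hψ, coe_relabelCM] using h

/-- ★★★ **`U(N)`: translation invariance of the Wilson expectations on polynomials, from bootstrap
uniqueness.** [folklore] -/
theorem integral_comp_translate_eq_wilson_uN [NeZero L] (N : ℕ) (β : ℝ) (a : Site d L)
    {f : C(GaugeConfig d L (Matrix.unitaryGroup (Fin N) ℂ), ℝ)}
    (hf : f ∈ polyAlgebra (ι := Edge d L) (unitaryFundamentalLatticeRep N)) :
    ∫ U, f (U ∘ translateEquiv a) ∂(wilsonMeasure (unitaryFundamentalRep (Fin N) ℂ) β) =
      ∫ U, f U ∂(wilsonMeasure (unitaryFundamentalRep (Fin N) ℂ) β) := by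
  haveI : IsProbabilityMeasure (wilsonMeasure (d := d) (L := L) (unitaryFundamentalRep (Fin N) ℂ) β) :=
    isProbabilityMeasure_wilsonMeasure (ρ := unitaryFundamentalRep (Fin N) ℂ)
      (continuous_unitaryFundamentalRep _ _) β
  have hsd : IsSDFunctional (unitaryFundamentalLatticeRep N) (uExp N)
      (fun _ => wilsonAction (unitaryFundamentalRep (Fin N) ℂ)) β
      (expectationFunctional (wilsonMeasure (d := d) (L := L) (unitaryFundamentalRep (Fin N) ℂ) β)) :=
    isSDFunctional_expectationFunctional (unitaryFundamentalLatticeRep N) (uExp_add N)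
      (X := fun X : UGenerator N => (X : Matrix (Fin N) (Fin N) ℂ)) (rho_uExp N)
      (fun _ => wilsonAction_mem_polyFunctions (unitaryFundamentalLatticeRep N)) _
      ((eq_wilsonMeasure_iff_polySD_uN N β _).1 rfl)
  set ψ := expectationFunctional (wilsonMeasure (d := d) (L := L) (unitaryFundamentalRep (Fin N) ℂ) β) ∘ₗ
    (ContinuousMap.compRightAlgHom ℝ ℝ (relabelCM (G := Matrix.unitaryGroup (Fin N) ℂ)
      (translateEquiv a))).toLinearMap with hψ
  have h := eq_wilson_of_bootstrap_uN (d := d) (L := L) N β (φ := ψ)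
    (by simp [hψ])
    (fun g _ => by
      have h0 := expectationFunctional_sq_nonneg
        (wilsonMeasure (d := d) (L := L) (unitaryFundamentalRep (Fin N) ℂ) β) (g.comp (relabelCM (translateEquiv a)))
      simpa [hψ] using h0)
    (hsd.comp_relabel _ (translateEquiv a)
      (wilsonAction_relabelCM_translate (unitaryFundamentalRep (Fin N) ℂ) a)) hf
  simpa [hψ, coe_relabelCM] using h

/-- ★★★ **`SU(N)`, torus: the loop equations at ONE base site suffice for a translation-invariant
functional.** A linear functional invariant on the polynomials under all translations
(`φ (g ∘ (· + a)) = φ g`) which satisfies the loop equations at the `d` links `(0, i)` satisfies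
them at every link (so with normalisation and positivity it is the Wilson expectation,
`eq_wilson_of_bootstrap_suN`). [folklore] -/
theorem isSDFunctional_of_translationInvariant_suN [NeZero L] (N : ℕ) (β : ℝ)
    {φ : C(GaugeConfig d L (Matrix.specialUnitaryGroup (Fin N) ℂ), ℝ) →ₗ[ℝ] ℝ}
    (hφ : ∀ (a : Site d L), ∀ g ∈ polyAlgebra (ι := Edge d L) (fundamentalLatticeRep N),
      φ (g.comp (relabelCM (translateEquiv a))) = φ g)
    (hrows : IsSDFunctionalAt (fundamentalLatticeRep N) (Set.range fun i : Fin d => ((0 : Site d L), i))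
      (suExp N) (fun _ => wilsonAction (fundamentalRep (Fin N))) β φ) :
    IsSDFunctional (fundamentalLatticeRep N) (suExp N) (fun _ => wilsonAction (fundamentalRep (Fin N))) β φ :=
  isSDFunctional_of_invariant_of_rows_at (fundamentalLatticeRep N) (suExp_add N)
    (X := fun X : SuGenerator N => (X : Matrix (Fin N) (Fin N) ℂ)) (rho_suExp N)
    (Set.range (translateEquiv (d := d) (L := L)))
    (by rintro _ ⟨a, rfl⟩ e U; exact wilsonAction_relabelCM_translate _ a e U)
    (by rintro _ ⟨a, rfl⟩ g hg; exact hφ a g hg) (Set.range fun i : Fin d => ((0 : Site d L), i))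
    (fun e => ⟨translateEquiv e.1, ⟨e.1, rfl⟩, ((0 : Site d L), e.2), ⟨e.2, rfl⟩, by simp⟩) hrows

/-- ★★★ **`U(N)`, torus: the loop equations at one base site suffice for a translation-invariant
functional.** [folklore] -/
theorem isSDFunctional_of_translationInvariant_uN [NeZero L] (N : ℕ) (β : ℝ)
    {φ : C(GaugeConfig d L (Matrix.unitaryGroup (Fin N) ℂ), ℝ) →ₗ[ℝ] ℝ}
    (hφ : ∀ (a : Site d L), ∀ g ∈ polyAlgebra (ι := Edge d L) (unitaryFundamentalLatticeRep N),
      φ (g.comp (relabelCM (translateEquiv a))) = φ g)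
    (hrows : IsSDFunctionalAt (unitaryFundamentalLatticeRep N) (Set.range fun i : Fin d => ((0 : Site d L), i))
      (uExp N) (fun _ => wilsonAction (unitaryFundamentalRep (Fin N) ℂ)) β φ) :
    IsSDFunctional (unitaryFundamentalLatticeRep N) (uExp N)
      (fun _ => wilsonAction (unitaryFundamentalRep (Fin N) ℂ)) β φ :=
  isSDFunctional_of_invariant_of_rows_at (unitaryFundamentalLatticeRep N) (uExp_add N)
    (X := fun X : UGenerator N => (X : Matrix (Fin N) (Fin N) ℂ)) (rho_uExp N)
    (Set.range (translateEquiv (d := d) (L := L)))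
    (by rintro _ ⟨a, rfl⟩ e U; exact wilsonAction_relabelCM_translate _ a e U)
    (by rintro _ ⟨a, rfl⟩ g hg; exact hφ a g hg) (Set.range fun i : Fin d => ((0 : Site d L), i))
    (fun e => ⟨translateEquiv e.1, ⟨e.1, rfl⟩, ((0 : Site d L), e.2), ⟨e.2, rfl⟩, by simp⟩) hrows

end Unitary

end Summit.QuantumFields.GaugeBoot

end
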